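import Summits.CriticalPhenomena.SAWScalingLimit.Theses.SAWDefectDecoherence
import Literature.NumberTheory.Transcendental.ExpDominantSolvabilityLogRatio

/-!
# `BoundaryClosureR`, line `pick-half-plane`, stub `stub_identification`: the last step of the
# closing argument — a limit of the right modulus and the right value at the normaliser IS the target

Sub-goal `identification_of_modulusPhase` of the stub `stub_identification` (crux
stmt-CriticalPhenomena-14004; the final "Schwarz reflection + identity theorem" step of the sibling
line's `stub_closingArgument`, in the interior form the Pick line needs).  Everything before it
(covariance of blow-ups, reciprocity, flat locality, flat trace, reflection across the gate) serves to
establish the MODULUS identity `‖g‖ = ‖K‖ · ‖exp((5/8)(L − L_b))‖` and the value `g → K` at the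
normaliser; this file proves that these two facts already pin `g = K · exp((5/8)(L − L_b))` on the
carrier, with NO zero-freeness hypothesis and no `K ≠ 0`:

* a continuous logarithm of a holomorphic function on an open set is holomorphic — the tree's
  `Literature.NumberTheory.Transcendental.ExpDominant.differentiableOn_of_exp_eq` (local inverse of `exp`);
* `eq_const_of_norm_eq_const` — a holomorphic function of constant modulus on a preconnected open set
  is constant (Mathlib's maximum modulus principle `Complex.eqOn_of_isPreconnected_of_isMaxOn_norm`:
  every point is a maximum);
* `identification_of_modulusPhase` — for a Dobrushin domain `D`, conformal `Φ : Ω → ℍₒ`, a continuous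
  branch `L` of `log Φ'` on the carrier with limit `L_b` at `D.pt 1`, and `g` holomorphic on the
  carrier with `‖g z‖ = ‖K‖ · ‖exp((5/8)(L z − L_b))‖` there and `g → K` at `D.pt 1` (within the
  carrier): `g = K · exp((5/8)(L − L_b))` on the carrier.  Proof: `L` is holomorphic, so
  `G := g · exp(−(5/8)(L − L_b))` is holomorphic of constant modulus `‖K‖` on the connected open
  carrier, hence a constant `c₀`; and `G → K · e⁰ = K` at `D.pt 1 ∈ closure Ω`, so `c₀ = K`.

Reference: the maximum modulus principle (Ahlfors, *Complex Analysis* (1979), Ch. 4 §3.4); the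
statement is route bookkeeping of ideas `two-root-quotient` / `pick-half-plane`.
-/

noncomputable section

open scoped Topology
open Filter Set Complex
open Literature.Probability.RandomPlanarGeometry

namespace Summit.CriticalPhenomena.SAWScalingLimit.Theorems.PickHalfPlane.Identification

/-- **A holomorphic function of constant modulus on a preconnected open set is constant** (maximum
modulus principle: every point is a maximum of the modulus). [folklore] -/
theorem eq_const_of_norm_eq_const {U : Set ℂ} (hU : IsOpen U) (hU' : IsPreconnected U) {G : ℂ → ℂ}
    (hG : DifferentiableOn ℂ G U) {r : ℝ} (hr : ∀ z ∈ U, ‖G z‖ = r) {z₁ : ℂ} (hz₁ : z₁ ∈ U) :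
    EqOn G (fun _ => G z₁) U :=
  Complex.eqOn_of_isPreconnected_of_isMaxOn_norm hU' hU hG hz₁ fun z hz => by
    simp only [Function.comp_apply, mem_setOf_eq, hr z hz, hr z₁ hz₁, le_refl]

/-- **The last step of the closing argument (sub-goal `identification_of_modulusPhase` of stub
`stub_identification`).** For a Dobrushin domain `D`, a conformal equivalence `Φ` of its carrier
onto `ℍₒ`, a continuous branch `L` of `log Φ'` on the carrier with limit `L_b` at the normaliser
`D.pt 1` (within the carrier), a constant `K` and a function `g` holomorphic on the carrier whose
MODULUS is the target's, `‖g z‖ = ‖K‖ · ‖exp((5/8)(L z − L_b))‖` on the carrier, and whose value at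
the normaliser is `K` (`g → K` at `D.pt 1` within the carrier): `g = K · exp((5/8)(L − L_b))` on the
carrier.  (`L` is holomorphic — `ExpDominant.differentiableOn_of_exp_eq` with `f = Φ'`; `G := g·exp(−(5/8)(L − L_b))`
is holomorphic of constant modulus `‖K‖` on the connected open carrier, hence constant,
`eq_const_of_norm_eq_const`; its limit at `D.pt 1 ∈ closure Ω` is `K`.)  No zero-freeness of `g`
and no `K ≠ 0` is needed. [folklore] -/
theorem identification_of_modulusPhase : ∀ (D : DobrushinDomain)
    (Φ : ConformalEquiv D.carrier UpperHalfPlane.upperHalfPlaneSet) (L : ℂ → ℂ) (Lb K : ℂ) (g : ℂ → ℂ),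
    ContinuousOn L D.carrier → (∀ z ∈ D.carrier, Complex.exp (L z) = deriv Φ z) →
    Tendsto L (𝓝[D.carrier] (D.pt 1)) (𝓝 Lb) → DifferentiableOn ℂ g D.carrier →
    (∀ z ∈ D.carrier, ‖g z‖ = ‖K‖ * ‖Complex.exp ((5 / 8 : ℂ) * (L z - Lb))‖) →
    Tendsto g (𝓝[D.carrier] (D.pt 1)) (𝓝 K) →
    ∀ z ∈ D.carrier, g z = K * Complex.exp ((5 / 8 : ℂ) * (L z - Lb)) := by
  intro D Φ L Lb K g hL hexpL hLb hg hmod hgK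
  have hU : IsOpen D.carrier := D.isOpen
  -- `L` is holomorphic (a continuous logarithm of the holomorphic `Φ'`)
  have hΦ' : DifferentiableOn ℂ (deriv Φ) D.carrier :=
    ((Φ.differentiableOn.analyticOnNhd hU).deriv).differentiableOn
  have hLd : DifferentiableOn ℂ L D.carrier :=
    Literature.NumberTheory.Transcendental.ExpDominant.differentiableOn_of_exp_eq hU hL hΦ' hexpL
  -- `G := g · exp(−(5/8)(L − L_b))` is holomorphic of constant modulus `‖K‖`
  set G : ℂ → ℂ := fun z => g z * exp (-((5 / 8 : ℂ) * (L z - Lb))) with hGdef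
  have hGd : DifferentiableOn ℂ G D.carrier :=
    hg.mul (((differentiableOn_const _).mul (hLd.sub (differentiableOn_const _))).neg.cexp)
  have hGmod : ∀ z ∈ D.carrier, ‖G z‖ = ‖K‖ := by
    intro z hz
    have h1 : ‖exp ((5 / 8 : ℂ) * (L z - Lb))‖ * ‖exp (-((5 / 8 : ℂ) * (L z - Lb)))‖ = 1 := by
      rw [← norm_mul, ← exp_add, add_neg_cancel, exp_zero, norm_one]
    rw [hGdef, norm_mul, hmod z hz, mul_assoc, h1, mul_one]
  -- hence constant on the connected open carrier
  obtain ⟨z₁, hz₁⟩ := D.nonempty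
  have hGc : EqOn G (fun _ => G z₁) D.carrier :=
    eq_const_of_norm_eq_const hU D.isConnected.isPreconnected hGd hGmod hz₁
  -- the constant is `K`: compare the limits at the normaliser
  haveI : NeBot (𝓝[D.carrier] (D.pt 1)) :=
    mem_closure_iff_nhdsWithin_neBot.1 (frontier_subset_closure (D.pt_mem_frontier 1))
  have hlim : Tendsto G (𝓝[D.carrier] (D.pt 1)) (𝓝 (K * exp (-((5 / 8 : ℂ) * (Lb - Lb))))) := by
    refine hgK.mul ?_
    exact ((continuous_exp.tendsto _).comp ((hLb.sub_const Lb).const_mul (5 / 8 : ℂ)).neg)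
  rw [sub_self, mul_zero, neg_zero, exp_zero, mul_one] at hlim
  have hlim' : Tendsto G (𝓝[D.carrier] (D.pt 1)) (𝓝 (G z₁)) :=
    tendsto_const_nhds.congr' (eventually_mem_nhdsWithin.mono fun z hz => (hGc hz).symm)
  have hK : G z₁ = K := tendsto_nhds_unique hlim' hlim
  -- unwind
  intro z hz
  have hGz : G z = K := (hGc hz).trans hK
  have h2 : exp (-((5 / 8 : ℂ) * (L z - Lb))) * exp ((5 / 8 : ℂ) * (L z - Lb)) = 1 := by
    rw [← exp_add, neg_add_cancel, exp_zero]
  calc g z = G z * exp ((5 / 8 : ℂ) * (L z - Lb)) := by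
        rw [hGdef]; simp only; rw [mul_assoc, h2, mul_one]
    _ = K * exp ((5 / 8 : ℂ) * (L z - Lb)) := by rw [hGz]

end Summit.CriticalPhenomena.SAWScalingLimit.Theorems.PickHalfPlane.Identification

end
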